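import Literature.NumberTheory.Transcendental.CalegariDimitrovTangL2Chi3Proofs
import Mathlib.Analysis.Analytic.OfScalars
import Mathlib.Analysis.SpecificLimits.Normed
import Mathlib.Data.Nat.Choose.Central
import Mathlib.Data.Nat.Choose.Sum
import Mathlib.Tactic
import HarnessLib

/-!
# The radius of convergence of `H_A(x) = Σ aₙ xⁿ` is `1/9` (CDT Lemma 121)

Calegari–Dimitrov–Tang, arXiv:2408.15403, §11.1 Lemma 121 (p. 101), third bullet: "The radius
of convergence of `H_A(x)`, `H_B(x)`, and `H_C(x)` is `R = 1/9`." For `H_A = Σ aₙ xⁿ`,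
`aₙ = Σ_k C(n,k)² C(2k,k)` (Zagier's sequence **C**), this is the elementary two-sided bound
`9ⁿ/((n+1)²(2n+1)) ≤ aₙ ≤ 9ⁿ`:
upper, `C(2k,k) ≤ 4^k` and `Σ_k C(n,k)² 4^k ≤ (Σ_k C(n,k) 2^k)² = 9ⁿ`; lower, the largest term of
`Σ_k C(n,k) 2^k = 3ⁿ` is `≥ 3ⁿ/(n+1)` and `(2k+1) C(2k,k) ≥ 4^k`.

* `CalegariDimitrovTang.zagierC_le_nine_pow` — `aₙ ≤ 9ⁿ`.
* `CalegariDimitrovTang.nine_pow_le_mul_zagierC` — `9ⁿ ≤ (n+1)² (2n+1) aₙ`.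
* `CalegariDimitrovTang.radius_ofScalars_zagierC` — **the radius of convergence of
  `Σ aₙ xⁿ` (over `ℂ`) is exactly `1/9`.**

No named facts. (The radius statements for `H_B`, `H_C`, defined in the tree through Zagier's
recurrence, and the overconvergence of `H_B − L(2,χ₋₃)/2·H_A`, `H_C − ζ(2)/4·H_A` to radius `1`
are not formalised here.)

## References

* [CalegariDimitrovTang2024] arXiv:2408.15403, §11.1 Lemma 121 (p. 101).
-/

noncomputable section

open Filter Topology NNReal ENNReal

namespace Literature.NumberTheory.Transcendental

namespace CalegariDimitrovTang

/-- `Σ_k C(n,k) 2^k = 3ⁿ`. [folklore] -/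
theorem sum_choose_mul_two_pow (n : ℕ) :
    ∑ k ∈ Finset.range (n + 1), n.choose k * 2 ^ k = 3 ^ n := by
  have h := (add_pow 2 1 n).symm
  simp only [one_pow, mul_one] at h
  rw [show (2 : ℕ) + 1 = 3 from rfl] at h
  rw [← h]
  exact Finset.sum_congr rfl fun k _ => by simp [Nat.cast_id, mul_comm]

/-- **`aₙ ≤ 9ⁿ`**. [cite: CalegariDimitrovTang2024, §11.1 Lemma 121 (radius `1/9`) (p. 101)] -/
theorem zagierC_le_nine_pow (n : ℕ) : zagierC n ≤ 9 ^ n := by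
  unfold zagierC
  calc ∑ k ∈ Finset.range (n + 1), n.choose k ^ 2 * (2 * k).choose k
      ≤ ∑ k ∈ Finset.range (n + 1), (n.choose k * 2 ^ k) ^ 2 := by
        refine Finset.sum_le_sum fun k _ => ?_
        have h : (2 * k).choose k ≤ 4 ^ k := by
          have := Nat.centralBinom_le_four_pow k
          rwa [Nat.centralBinom_eq_two_mul_choose] at this
        calc n.choose k ^ 2 * (2 * k).choose k ≤ n.choose k ^ 2 * 4 ^ k :=
              Nat.mul_le_mul_left _ h
          _ = (n.choose k * 2 ^ k) ^ 2 := by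
              rw [show (4 : ℕ) = 2 ^ 2 from rfl, ← pow_mul, mul_pow, ← pow_mul, mul_comm 2 k]
    _ ≤ (∑ k ∈ Finset.range (n + 1), n.choose k * 2 ^ k) ^ 2 :=
        Finset.sum_sq_le_sq_sum_of_nonneg fun k _ => Nat.zero_le _
    _ = 9 ^ n := by
        rw [sum_choose_mul_two_pow, ← pow_mul, mul_comm, pow_mul]
        norm_num

/-- **`9ⁿ ≤ (n+1)² (2n+1) aₙ`**.
[cite: CalegariDimitrovTang2024, §11.1 Lemma 121 (radius `1/9`) (p. 101)] -/
theorem nine_pow_le_mul_zagierC (n : ℕ) : 9 ^ n ≤ (n + 1) ^ 2 * (2 * n + 1) * zagierC n := by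
  classical
  -- a largest term `C(n,k₀) 2^{k₀}` of `Σ_k C(n,k) 2^k = 3ⁿ`
  obtain ⟨k₀, hk₀, hmax⟩ := Finset.exists_max_image (Finset.range (n + 1))
    (fun k => n.choose k * 2 ^ k) ⟨0, by simp⟩
  have hk₀n : k₀ ≤ n := Nat.lt_succ_iff.mp (Finset.mem_range.mp hk₀)
  have h1 : 3 ^ n ≤ (n + 1) * (n.choose k₀ * 2 ^ k₀) := by
    rw [← sum_choose_mul_two_pow]
    calc ∑ k ∈ Finset.range (n + 1), n.choose k * 2 ^ k
        ≤ ∑ _k ∈ Finset.range (n + 1), n.choose k₀ * 2 ^ k₀ := Finset.sum_le_sum hmax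
      _ = (n + 1) * (n.choose k₀ * 2 ^ k₀) := by
          rw [Finset.sum_const, Finset.card_range, smul_eq_mul]
  -- `4^{k₀} ≤ (2k₀+1) C(2k₀,k₀)`
  have h2 : 4 ^ k₀ ≤ (2 * k₀ + 1) * (2 * k₀).choose k₀ :=
    Nat.four_pow_le_two_mul_add_one_mul_central_binom k₀
  -- the single term bounds the sum
  have h3 : n.choose k₀ ^ 2 * (2 * k₀).choose k₀ ≤ zagierC n := by
    unfold zagierC
    exact Finset.single_le_sum (f := fun k => n.choose k ^ 2 * (2 * k).choose k)
      (fun k _ => Nat.zero_le _) hk₀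
  calc 9 ^ n = (3 ^ n) ^ 2 := by rw [← pow_mul, mul_comm, pow_mul]; norm_num
    _ ≤ ((n + 1) * (n.choose k₀ * 2 ^ k₀)) ^ 2 := Nat.pow_le_pow_left h1 2
    _ = (n + 1) ^ 2 * n.choose k₀ ^ 2 * 4 ^ k₀ := by
        rw [show (4 : ℕ) = 2 ^ 2 from rfl, ← pow_mul, mul_comm 2 k₀, pow_mul]; ring
    _ ≤ (n + 1) ^ 2 * n.choose k₀ ^ 2 * ((2 * k₀ + 1) * (2 * k₀).choose k₀) :=
        Nat.mul_le_mul_left _ h2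
    _ ≤ (n + 1) ^ 2 * n.choose k₀ ^ 2 * ((2 * n + 1) * (2 * k₀).choose k₀) := by
        gcongr
    _ = (n + 1) ^ 2 * (2 * n + 1) * (n.choose k₀ ^ 2 * (2 * k₀).choose k₀) := by ring
    _ ≤ (n + 1) ^ 2 * (2 * n + 1) * zagierC n := Nat.mul_le_mul_left _ h3

/-- **The radius of convergence of `H_A(x) = Σ aₙ xⁿ` is `1/9`** (as a complex power series).
[cite: CalegariDimitrovTang2024, §11.1 Lemma 121, third bullet (p. 101)] -/
theorem radius_ofScalars_zagierC :
    (FormalMultilinearSeries.ofScalars ℂ (fun n => (zagierC n : ℂ))).radius = ((1 / 9 : ℝ≥0) : ℝ≥0∞) := by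
  set p := FormalMultilinearSeries.ofScalars ℂ (fun n => (zagierC n : ℂ)) with hp
  have hnorm : ∀ n, ‖p n‖ = (zagierC n : ℝ) := by
    intro n
    rw [hp, FormalMultilinearSeries.ofScalars_norm, Complex.norm_natCast]
  apply le_antisymm
  · -- `radius ≤ 1/9`: otherwise `aₙ rⁿ` would be bounded for some `r > 1/9`
    by_contra hlt
    rw [not_le] at hlt
    obtain ⟨r, h19r, hrp⟩ := ENNReal.lt_iff_exists_nnreal_btwn.mp hlt
    obtain ⟨C, hC0, hC⟩ := p.norm_mul_pow_le_of_lt_radius hrp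
    have hr : (1 / 9 : ℝ) < r := by
      have : ((1 / 9 : ℝ≥0) : ℝ≥0∞) < r := h19r
      exact_mod_cast this
    have h9r : 1 < 9 * (r : ℝ) := by linarith
    -- `(9r)ⁿ ≤ C (n+1)² (2n+1)` for all `n`, contradicting exponential growth
    have hbound : ∀ n : ℕ, (9 * (r : ℝ)) ^ n ≤ C * ((n + 1) ^ 2 * (2 * n + 1)) := by
      intro n
      have h1 := hC n
      rw [hnorm] at h1
      have h2 : (9 : ℝ) ^ n ≤ (n + 1) ^ 2 * (2 * n + 1) * zagierC n := by
        exact_mod_cast nine_pow_le_mul_zagierC n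
      have hrn : (0 : ℝ) ≤ (r : ℝ) ^ n := by positivity
      calc (9 * (r : ℝ)) ^ n = 9 ^ n * (r : ℝ) ^ n := mul_pow _ _ _
        _ ≤ ((n + 1) ^ 2 * (2 * n + 1) * zagierC n) * (r : ℝ) ^ n :=
            mul_le_mul_of_nonneg_right h2 hrn
        _ = ((n + 1) ^ 2 * (2 * n + 1)) * ((zagierC n : ℝ) * (r : ℝ) ^ n) := by ring
        _ ≤ ((n + 1) ^ 2 * (2 * n + 1)) * C := by
            exact mul_le_mul_of_nonneg_left h1 (by positivity)
        _ = C * ((n + 1) ^ 2 * (2 * n + 1)) := by ring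
    -- `n³ / (9r)ⁿ → 0`
    have hlim := tendsto_pow_const_div_const_pow_of_one_lt 3 h9r
    have hev : ∀ᶠ n : ℕ in atTop, (n : ℝ) ^ 3 / (9 * (r : ℝ)) ^ n < 1 / (12 * (C + 1)) :=
      hlim.eventually (gt_mem_nhds (by positivity))
    obtain ⟨N, hN⟩ := (hev.and (eventually_ge_atTop 1)).exists
    obtain ⟨hN1, hN2⟩ := hN
    have hpos : (0 : ℝ) < (9 * (r : ℝ)) ^ N := by positivity
    rw [div_lt_iff₀ hpos, one_div_mul_eq_div, lt_div_iff₀ (by positivity)] at hN1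
    have hN2' : (1 : ℝ) ≤ N := by exact_mod_cast hN2
    have hb := hbound N
    -- `(N+1)²(2N+1) ≤ 12 N³` for `N ≥ 1`
    have hpoly : ((N : ℝ) + 1) ^ 2 * (2 * N + 1) ≤ 12 * (N : ℝ) ^ 3 := by
      have e : ((N : ℝ) + 1) ^ 2 * (2 * N + 1) = 2 * (N : ℝ) ^ 3 + 5 * (N : ℝ) ^ 2 + 4 * N + 1 := by
        ring
      have hN3 : (N : ℝ) ^ 2 ≤ (N : ℝ) ^ 3 := pow_le_pow_right₀ hN2' (by norm_num)
      have hN31 : (N : ℝ) ≤ (N : ℝ) ^ 3 := le_self_pow₀ hN2' (by norm_num)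
      have hN30 : (1 : ℝ) ≤ (N : ℝ) ^ 3 := one_le_pow₀ hN2'
      rw [e]
      linarith
    have h1 : (9 * (r : ℝ)) ^ N ≤ C * (12 * (N : ℝ) ^ 3) :=
      hb.trans (mul_le_mul_of_nonneg_left hpoly hC0.le)
    have hY : (1 : ℝ) ≤ (N : ℝ) ^ 3 := one_le_pow₀ hN2'
    nlinarith
  · -- `1/9 ≤ radius`: `aₙ (1/9)ⁿ ≤ 1`
    refine p.le_radius_of_bound 1 fun n => ?_
    rw [hnorm]
    have h := zagierC_le_nine_pow n
    have h' : (zagierC n : ℝ) ≤ 9 ^ n := by exact_mod_cast h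
    rw [NNReal.coe_div, NNReal.coe_one]
    push_cast
    rw [one_div, inv_pow, ← div_eq_mul_inv, div_le_one (by positivity)]
    exact h'

end CalegariDimitrovTang

end Literature.NumberTheory.Transcendental
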